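import Summits.CriticalPhenomena.CardyFormulaZ2.Theorems.CardyAnchoredRigidityCardyShadowIsolatedStubDilationFlow
import Summits.CriticalPhenomena.CardyFormulaZ2.Theorems.CardyAnchoredRigidityCardyShadowIsolatedDilationDynamicsGlue
import Summits.CriticalPhenomena.CardyFormulaZ2.Theses.CardyAnchoredRigidity
import Summits.CriticalPhenomena.CardyFormulaZ2.Theses.CardyLocalRigidity
import Summits.CriticalPhenomena.CardyFormulaZ2.Theses.CardyUniqueLimit
import HarnessLib

/-!
# Crux `CardyShadowIsolated` (stmt-CriticalPhenomena-5767): the bridge from `LimitExists`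

Cross-route bookkeeping for the shared crux `CardyShadowIsolated` (routes CardyLocalRigidity /
CardyAnchoredRigidity) of `CardyFormulaZ2`.  The sibling route CardyUniqueLimit carries the crux
`LimitExists` (stmt-CriticalPhenomena-0747):

    ∀ R, ∃ L, bondDomainCrossingProb R δ → L   as δ → 0⁺,

existence of the crossing limit for every conformal rectangle, nothing said about its value.
This file records, sorry-free, that `LimitExists` makes the product-space cluster set
`Λ' = clusterSet` a subsingleton (`clusterSet_subsingleton_of_limitExists`: every coordinate of
the path converges, so the path converges in the product topology, and a cluster point of a
convergent net in a Hausdorff space is its limit), hence implies OUTRIGHT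

* the crux `CardyShadowIsolated` for both route decls (`CardyShadowIsolated_of_limitExists`,
  `…_local`; by name from the CardyUniqueLimit decl: `CardyShadowIsolated_of_LimitExists`);
* every registered stub of the lead's skeleton (line `dilation-dynamics` v4): C
  `stub_cardyIsolatedInvariant`, D `stub_cardyUnstableTrivial`, E `stub_cardyStableTrivial`,
  S2 `stub_cardyIsolatedAmongFixed` (all trivial on a subsingleton `Λ'`) and S1
  `stub_latticeTwoLags` (a convergent function has vanishing mesh-halving / mesh-thirding lags).

So on the ladder of open statements about bond-`ℤ²` crossing probabilities,

    CardyFormulaZ2 ⇒ LimitExists ⇒ S1 ⇒ (D ∧ E),   LimitExists ⇒ crux ⇒ C ⇒ S2,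

every arrow being a tree theorem (this file, `…LagInvariance`, `…DilationDynamicsGlue`); the
crux is the conjunct of `CardyFormulaZ2` complementary to `SubseqCardy` (`g_F ∈ Λ'`), and
`LimitExists` is the strongest single open item below the summit that settles it.  Nothing here
is a proof of the crux: `LimitExists` is open (Schramm, ICM 2006, Problem 2.11).

References: O. Schramm, *Conformally invariant scaling limits: an overview and a collection of
problems*, Proc. ICM 2006, §2.6 Problem 2.11; B. Bollobás, O. Riordan, *Percolation* (2006),
Ch. 7, Conjecture 1; O. Schramm, S. Smirnov, Ann. Probab. 39 (2011), §1; S. Smirnov, C. R. Acad.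
Sci. 333 (2001), Thm 1.
-/

noncomputable section

namespace Summit.CriticalPhenomena.CardyFormulaZ2.Theorems.CardyShadowIsolated.UniqueLimit

open Set Filter Topology
open Literature.Probability.RandomPlanarGeometry Literature.Probability.Percolation
open Summit.CriticalPhenomena.CardyFormulaZ2.Theorems.CardyShadowIsolated.DilationDynamics

/-! ### `LimitExists` ⇒ `Λ'` is a subsingleton -/

/-- **Existence of every coordinate limit makes the cluster set a subsingleton**: the path
converges in the product topology (`tendsto_pi_nhds`) and a cluster point of a convergent net
in a Hausdorff space is the limit (`eq_of_nhds_neBot`).  Hypothesis = `LimitExists`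
(stmt-CriticalPhenomena-0747) verbatim. [cite: SchrammSmirnov2011, §1] -/
theorem clusterSet_subsingleton_of_limitExists
    (hL : ∀ R : ConformalRectangle, ∃ L : ℝ,
      Tendsto (bondDomainCrossingProb R) (nhdsWithin 0 (Set.Ioi 0)) (nhds L)) :
    clusterSet.Subsingleton := by
  classical
  choose L hL using hL
  have ht : Tendsto (fun (δ : ℝ) (R : ConformalRectangle) => bondDomainCrossingProb R δ)
      (nhdsWithin (0 : ℝ) (Set.Ioi 0)) (𝓝 fun R => L R) :=
    tendsto_pi_nhds.2 fun R => hL R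
  have key : ∀ g ∈ clusterSet, g = fun R => L R := by
    intro g hg
    have hg' : MapClusterPt g (nhdsWithin (0 : ℝ) (Set.Ioi 0))
        (fun (δ : ℝ) (R : ConformalRectangle) => bondDomainCrossingProb R δ) := hg
    exact eq_of_nhds_neBot (hg'.clusterPt.mono ht).neBot
  intro g hg g' hg'
  rw [key g hg, key g' hg']

/-- Under `LimitExists`, every cluster point is fixed by every dilation (`Λ'` is invariant,
`scaleAct_mem_clusterSet`, and a subsingleton). [cite: SchrammSmirnov2011, §1] -/
theorem scaleFixed_of_limitExists
    (hL : ∀ R : ConformalRectangle, ∃ L : ℝ,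
      Tendsto (bondDomainCrossingProb R) (nhdsWithin 0 (Set.Ioi 0)) (nhds L)) :
    ∀ g ∈ clusterSet, ∀ s : ℝ, scaleAct s g = g :=
  fun _ hg s => clusterSet_subsingleton_of_limitExists hL (scaleAct_mem_clusterSet hg s) hg

/-! ### `LimitExists` ⇒ the crux, by name, for both route decls -/

/-- **`LimitExists` ⇒ `CardyShadowIsolated`** (route CardyAnchoredRigidity): on a subsingleton
cluster set every point is isolated (`U := univ`). [cite: Schramm2007ICM, §2.6 Problem 2.11] -/
theorem CardyShadowIsolated_of_limitExists
    (hL : ∀ R : ConformalRectangle, ∃ L : ℝ,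
      Tendsto (bondDomainCrossingProb R) (nhdsWithin 0 (Set.Ioi 0)) (nhds L)) :
    Summit.CriticalPhenomena.CardyFormulaZ2.Theses.CardyAnchoredRigidity.CardyShadowIsolated :=
  fun _ _ hg => ⟨univ, univ_mem, fun _ _ hg' => clusterSet_subsingleton_of_limitExists hL hg' hg⟩

/-- **`LimitExists` ⇒ `CardyShadowIsolated`** (route CardyLocalRigidity, the primary route of
the shared item). [cite: Schramm2007ICM, §2.6 Problem 2.11] -/
theorem CardyShadowIsolated_local_of_limitExists
    (hL : ∀ R : ConformalRectangle, ∃ L : ℝ,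
      Tendsto (bondDomainCrossingProb R) (nhdsWithin 0 (Set.Ioi 0)) (nhds L)) :
    Summit.CriticalPhenomena.CardyFormulaZ2.Theses.CardyLocalRigidity.CardyShadowIsolated :=
  fun _ _ hg => ⟨univ, univ_mem, fun _ _ hg' => clusterSet_subsingleton_of_limitExists hL hg' hg⟩

/-- **By name from the sibling route**: `CardyUniqueLimit.LimitExists` (stmt-CriticalPhenomena-0747)
implies the crux (route CardyAnchoredRigidity). CONDITIONAL on that open item; recorded for
the tenure planner's cross-route ledger. [cite: Schramm2007ICM, §2.6 Problem 2.11] -/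
theorem CardyShadowIsolated_of_LimitExists
    (hL : Summit.CriticalPhenomena.CardyFormulaZ2.Theses.CardyUniqueLimit.LimitExists) :
    Summit.CriticalPhenomena.CardyFormulaZ2.Theses.CardyAnchoredRigidity.CardyShadowIsolated :=
  CardyShadowIsolated_of_limitExists hL

/-- The same for route CardyLocalRigidity. [cite: Schramm2007ICM, §2.6 Problem 2.11] -/
theorem CardyShadowIsolated_local_of_LimitExists
    (hL : Summit.CriticalPhenomena.CardyFormulaZ2.Theses.CardyUniqueLimit.LimitExists) :
    Summit.CriticalPhenomena.CardyFormulaZ2.Theses.CardyLocalRigidity.CardyShadowIsolated :=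
  CardyShadowIsolated_local_of_limitExists hL

/-! ### `LimitExists` ⇒ every registered stub of the skeleton -/

/-- `LimitExists` ⇒ stub C `stub_cardyIsolatedInvariant` (verbatim as conclusion). [folklore] -/
theorem cardyIsolatedInvariant_of_limitExists
    (hL : ∀ R : ConformalRectangle, ∃ L : ℝ,
      Tendsto (bondDomainCrossingProb R) (nhdsWithin 0 (Set.Ioi 0)) (nhds L)) :
    ∀ g : ConformalRectangle → ℝ, IsCardyShadow g → g ∈ clusterSet →
      ∃ N ∈ 𝓝 g, ∀ g' ∈ clusterSet, (∀ s : ℝ, scaleAct s g' ∈ N) → g' = g :=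
  fun _ _ hg => ⟨univ, univ_mem, fun _ hg' _ => clusterSet_subsingleton_of_limitExists hL hg' hg⟩

/-- `LimitExists` ⇒ stub D `stub_cardyUnstableTrivial` (verbatim as conclusion): the limit `g`
of the backward orbit lies in the closed invariant set `Λ'`, which is a subsingleton. [folklore] -/
theorem cardyUnstableTrivial_of_limitExists
    (hL : ∀ R : ConformalRectangle, ∃ L : ℝ,
      Tendsto (bondDomainCrossingProb R) (nhdsWithin 0 (Set.Ioi 0)) (nhds L)) :
    ∀ g : ConformalRectangle → ℝ, IsCardyShadow g → ∀ g' ∈ clusterSet,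
      Tendsto (fun s : ℝ => scaleAct s g') atBot (𝓝 g) → g' = g := by
  intro g _ g' hg' ht
  have hconst : (fun s : ℝ => scaleAct s g') = fun _ => g' :=
    funext fun s => scaleFixed_of_limitExists hL g' hg' s
  rw [hconst] at ht
  exact tendsto_nhds_unique tendsto_const_nhds ht

/-- `LimitExists` ⇒ stub E `stub_cardyStableTrivial` (verbatim as conclusion). [folklore] -/
theorem cardyStableTrivial_of_limitExists
    (hL : ∀ R : ConformalRectangle, ∃ L : ℝ,
      Tendsto (bondDomainCrossingProb R) (nhdsWithin 0 (Set.Ioi 0)) (nhds L)) :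
    ∀ g : ConformalRectangle → ℝ, IsCardyShadow g → ∀ g' ∈ clusterSet,
      Tendsto (fun s : ℝ => scaleAct s g') atTop (𝓝 g) → g' = g := by
  intro g _ g' hg' ht
  have hconst : (fun s : ℝ => scaleAct s g') = fun _ => g' :=
    funext fun s => scaleFixed_of_limitExists hL g' hg' s
  rw [hconst] at ht
  exact tendsto_nhds_unique tendsto_const_nhds ht

/-- `LimitExists` ⇒ stub S2 `stub_cardyIsolatedAmongFixed` (verbatim as conclusion). [folklore] -/
theorem isolatedAmongFixed_of_limitExists
    (hL : ∀ R : ConformalRectangle, ∃ L : ℝ,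
      Tendsto (bondDomainCrossingProb R) (nhdsWithin 0 (Set.Ioi 0)) (nhds L)) :
    ∀ g : ConformalRectangle → ℝ, IsCardyShadow g → g ∈ clusterSet →
      ∃ N ∈ 𝓝 g, ∀ g' ∈ clusterSet, g' ∈ N → (∀ s : ℝ, scaleAct s g' = g') → g' = g :=
  fun _ _ hg => ⟨univ, univ_mem, fun _ hg' _ _ => clusterSet_subsingleton_of_limitExists hL hg' hg⟩

/-- `LimitExists` ⇒ stub S1 `stub_latticeTwoLags` (verbatim as conclusion): a function with a
limit at `0⁺` has vanishing lags along `δ ↦ δ / k`, `k > 0`. [folklore] -/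
theorem latticeTwoLags_of_limitExists
    (hL : ∀ R : ConformalRectangle, ∃ L : ℝ,
      Tendsto (bondDomainCrossingProb R) (nhdsWithin 0 (Set.Ioi 0)) (nhds L)) :
    ∀ R : ConformalRectangle,
      Tendsto (fun δ : ℝ => bondDomainCrossingProb R (δ / 2) - bondDomainCrossingProb R δ)
          (nhdsWithin (0 : ℝ) (Set.Ioi 0)) (𝓝 0) ∧
        Tendsto (fun δ : ℝ => bondDomainCrossingProb R (δ / 3) - bondDomainCrossingProb R δ)
          (nhdsWithin (0 : ℝ) (Set.Ioi 0)) (𝓝 0) := by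
  intro R
  obtain ⟨L, hRL⟩ := hL R
  have hdiv : ∀ {k : ℝ}, 0 < k →
      Tendsto (fun δ : ℝ => δ / k) (nhdsWithin (0 : ℝ) (Set.Ioi 0)) (nhdsWithin (0 : ℝ) (Set.Ioi 0)) := by
    intro k hk
    refine tendsto_nhdsWithin_of_tendsto_nhds_of_eventually_within _ ?_ ?_
    · have h : Tendsto (fun δ : ℝ => δ / k) (𝓝 0) (𝓝 (0 / k)) := tendsto_id.div_const k
      rw [zero_div] at h
      exact h.mono_left nhdsWithin_le_nhds
    · filter_upwards [self_mem_nhdsWithin] with δ hδ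
      exact div_pos (Set.mem_Ioi.1 hδ) hk
  have hlag : ∀ {k : ℝ}, 0 < k →
      Tendsto (fun δ : ℝ => bondDomainCrossingProb R (δ / k) - bondDomainCrossingProb R δ)
        (nhdsWithin (0 : ℝ) (Set.Ioi 0)) (𝓝 0) := by
    intro k hk
    have h1 : Tendsto (fun δ : ℝ => bondDomainCrossingProb R (δ / k))
        (nhdsWithin (0 : ℝ) (Set.Ioi 0)) (nhds L) := hRL.comp (hdiv hk)
    have h2 := h1.sub hRL
    rwa [sub_self] at h2
  exact ⟨hlag two_pos, hlag three_pos⟩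

/-! ### Registered stub of the lead's skeleton -/

/-- **`stub_limitExistsGlue`** (registered on stmt-CriticalPhenomena-5767): `LimitExists`
(stmt-CriticalPhenomena-0747, verbatim) ⇒ the crux (route CardyAnchoredRigidity).
[cite: Schramm2007ICM, §2.6 Problem 2.11] -/
theorem stub_limitExistsGlue :
    (∀ R : Literature.Probability.RandomPlanarGeometry.ConformalRectangle, ∃ L : ℝ,
      Filter.Tendsto (Literature.Probability.Percolation.bondDomainCrossingProb R)
        (nhdsWithin 0 (Set.Ioi 0)) (nhds L)) →
    Summit.CriticalPhenomena.CardyFormulaZ2.Theses.CardyAnchoredRigidity.CardyShadowIsolated :=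
  fun hL => CardyShadowIsolated_of_limitExists hL

end Summit.CriticalPhenomena.CardyFormulaZ2.Theorems.CardyShadowIsolated.UniqueLimit

end
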